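import Summits.QuantumFields.BalabanUV.T4Continuum.Support.NE3SmoothRightInverseBounds
import HarnessLib

/-!
# T⁴ programme, node NE3 — route Π, row Π-R, file Π-R♭-4e: THE ℓ¹ LETTER OF THE SMOOTH RIGHT INVERSE AT `W = 1`
# `Σ_{y∈periodBox(M·N)} Σ_α ‖R φ y α‖ ≤ 24·8^{d−1}·(1 + 2^d·d²)·M^{d−1}·Σ_{z∈periodBox N} Σ_κ ‖φ z κ‖` (`M = L^{j+1}`; d = 4: `3 158 016·M³`)

NE3 (node U1b) formalisation swarm, leaf seat `b2b-balaban-t4-ne3-formalise-leaf-01` (gen 7); owner GO ρ-g24-3 (4).  The owner's `DecomposedRep` (p237527,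
`NE3ProductPathChart`) carries, besides the weighted norm and the ℓ¹-curl of the normal part, its ℓ¹ NORM (`l1N : a·((α+αN)·dirL1 N …) ≤ κ₂·‖X‖²`); the normal part
is the right inverse applied to the quadratic remainder, so the right inverse needs an ℓ¹ → ℓ¹ letter with the natural scaling `M^{d−1}` (amplitude `φ∕M` spread over
`M^d` sites).  Lift part: `‖A y α‖ ≤ (C∕M)‖φ (blk y) α‖` (Π-R♭-4a) summed block by block.  Corrector: `E = (1∕M)•interp^⊥(cfd G)` and the ℓ¹ CONVEXITY bound
`‖interp M S F y‖ ≤ Σ_{T⊆S} ‖F (blk y + indic T)‖` (this file, the `‖·‖` twin of H3's `normSq_interp_le`), summed block by block with the shift-invariance of periodic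
sums (`Σ_y ‖dPot (interp M univ m) y ·‖ ≤ 2^{d−1}·M^{d−1}·Σ_z ‖dPot m z ·‖`, the `‖·‖` twin of H3's `sum_normSq_dPot_interp_le`), and the block-local frame bound of
Π-R♭-4d (`‖G z‖ ≤ d·C·Σ_κ‖φ z κ‖`).

CONTENT ([folklore]; 0 sorry; 0 def): §1 `norm_convex_le`, `norm_interpCore_le_sum`, `norm_interp_le_sum`, **`sum_norm_dPot_interp_le`**; §2 `sum_norm_smoothLift_le`,
`sum_norm_corrector_le`, **`sum_norm_smoothRightInverse_le`** (`L ≥ 2`, `d ≥ 1`, `N ≥ 1`, `φ` `N`-periodic).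

HONEST FRAMING.  Flat kinematics of OUR objects (`W = 1`); (P♮)_W, T-E_w and **NE3 are NOT proved**; spine PROVED 0∕9; finite T⁴ rung (B)+1 — NOT infinite volume,
NOT mass gap, NOT `BetaPertH`, NOT Clay.  PLACEMENT: `Summits/QuantumFields/BalabanUV/`.  HONEST DEPENDENCY (cell page 1): continuum YM on T⁴ ⇐ BetaPertH ∧ nine
spine estimates (0/9 proved); BetaPertH ⇐ (D1) ∧ (D4) ∧ CAP+tail; G-an2-4 gates asym, D1 and NE2/3/4.
-/

set_option autoImplicit false

open scoped BigOperators Matrix.Norms.L2Operator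
open Finset

namespace Summit.QuantumFields.BalabanUV.T4Continuum.NE3SmoothRightInverseL1

open Literature.MathematicalPhysics.QuantumFieldTheory.Balaban1983to89
open B7Prop1Explicit B7Prop2Explicit
open T4AveragingDeficitWallBoundary (periodBox mem_periodBox card_periodBox sum_periodBox_shift)
open SmoothRefineBlocks (blk)
open SmoothRefineInterp (interp interpCore interpCore_empty interpCore_insert indic indic_insert cfd wt wt_nonneg wt_le_one)
open NE3TangentNoGoWords (dPot)
open NE3TangentFlatStructure (framePot)
open NE3CoarseInterpolant (dPot_interp blk_block)
open NE3BlockLineAverage (sum_periodBox_blocks)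
open NE3SmoothLiftFlat (smoothLift)
open NE3SmoothLiftBounds (norm_smoothLift_le)
open NE3SmoothRightInverseFlat (smoothRightInverse)
open NE3SmoothRightInverseBounds (norm_framePot_smoothLift_le framePot_smoothLift_add_period two_le_pow_succ)

noncomputable section

variable {d : ℕ} {n : Type*} [Fintype n] [DecidableEq n]

/-! ## §1 ℓ¹ convexity of the interpolant and the ℓ¹ norm of its coboundary -/

section Convexity

variable {X : Type*} [NormedAddCommGroup X] [NormedSpace ℝ X]

/-- `‖(1 − t)•A + t•B‖ ≤ ‖A‖ + ‖B‖` for `t ∈ [0,1]`. [folklore] -/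
theorem norm_convex_le {t : ℝ} (ht0 : 0 ≤ t) (ht1 : t ≤ 1) (A B : X) : ‖(1 - t) • A + t • B‖ ≤ ‖A‖ + ‖B‖ := by
  calc ‖(1 - t) • A + t • B‖ ≤ ‖(1 - t) • A‖ + ‖t • B‖ := norm_add_le _ _
    _ = (1 - t) * ‖A‖ + t * ‖B‖ := by
        rw [norm_smul, norm_smul, Real.norm_of_nonneg ht0, Real.norm_of_nonneg (by linarith)]
    _ ≤ ‖A‖ + ‖B‖ := by nlinarith [norm_nonneg A, norm_nonneg B]

/-- **ℓ¹ LOCAL CONVEXITY**: for weights in `[0,1]`, `‖interpCore S G z w‖ ≤ Σ_{T ⊆ S} ‖G (z + indic T)‖`. [folklore] -/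
theorem norm_interpCore_le_sum (S : Finset (Fin d)) {w : Fin d → ℝ} (hw0 : ∀ i, 0 ≤ w i) (hw1 : ∀ i, w i ≤ 1) :
    ∀ (G : Site d → X) (z : Site d), ‖interpCore S G z w‖ ≤ ∑ T ∈ S.powerset, ‖G (z + indic T)‖ := by
  induction S using Finset.induction_on with
  | empty => intro G z; simp
  | insert i S hi ih =>
    intro G z
    rw [interpCore_insert hi, Finset.sum_powerset_insert hi]
    refine (norm_convex_le (hw0 i) (hw1 i) _ _).trans (add_le_add (ih G z) ?_)
    have h := ih (fun x => G (x + e i)) z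
    refine h.trans (le_of_eq (Finset.sum_congr rfl fun T hT => ?_))
    have hiT : i ∉ T := fun h' => hi (Finset.mem_powerset.1 hT h')
    rw [indic_insert hiT, ← add_assoc, add_right_comm z (indic T) (e i)]

/-- … on the fine lattice: `‖interp M S G y‖ ≤ Σ_{T ⊆ S} ‖G (blk M y + indic T)‖`. [folklore] -/
theorem norm_interp_le_sum {M : ℕ} (hM : 1 ≤ M) (S : Finset (Fin d)) (G : Site d → X) (y : Site d) :
    ‖interp M S G y‖ ≤ ∑ T ∈ S.powerset, ‖G (blk M y + indic T)‖ :=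
  norm_interpCore_le_sum S (wt_nonneg hM y) (wt_le_one hM y) G _

end Convexity

/-- **THE ℓ¹ NORM OF THE INTERPOLANT'S COBOUNDARY** against the datum's coarse differences: `M, N ≥ 1`, `m` `N`-periodic ⇒
`Σ_{y∈periodBox(M·N)} Σ_α ‖dPot (interp M univ m) y α‖ ≤ 2^{d−1}·(M^d∕M)·Σ_{z∈periodBox N} Σ_α ‖dPot m z α‖`. [folklore] -/
theorem sum_norm_dPot_interp_le {M N : ℕ} (hM : 1 ≤ M) (hN : 1 ≤ N) {m : Site d → Matrix n n ℂ}
    (hm : ∀ (z : Site d) (τ : Fin d), m (z + (N : ℤ) • e τ) = m z) :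
    ∑ y ∈ periodBox (d := d) (M * N), ∑ α : Fin d, ‖dPot (interp M Finset.univ m) y α‖
      ≤ (2 : ℝ) ^ (d - 1) * ((M : ℝ) ^ d / (M : ℝ)) * ∑ z ∈ periodBox (d := d) N, ∑ α : Fin d, ‖dPot m z α‖ := by
  have hM0 : (0 : ℝ) < M := by exact_mod_cast (by omega : 0 < M)
  have hpt : ∀ (y : Site d) (α : Fin d), ‖dPot (interp M Finset.univ m) y α‖
      ≤ (1 / (M : ℝ)) * ∑ T ∈ (Finset.univ.erase α).powerset, ‖dPot m (blk M y + indic T) α‖ := by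
    intro y α
    rw [dPot_interp hM m y α, norm_smul, Real.norm_of_nonneg (by positivity)]
    exact mul_le_mul_of_nonneg_left (norm_interp_le_sum hM _ (cfd α m) y) (by positivity)
  have hblocks : ∑ y ∈ periodBox (d := d) (M * N), ∑ α : Fin d,
      (1 / (M : ℝ)) * ∑ T ∈ (Finset.univ.erase α).powerset, ‖dPot m (blk M y + indic T) α‖
      = (M : ℝ) ^ d * ∑ z ∈ periodBox (d := d) N, ∑ α : Fin d,
          (1 / (M : ℝ)) * ∑ T ∈ (Finset.univ.erase α).powerset, ‖dPot m (z + indic T) α‖ := by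
    rw [← sum_periodBox_blocks M N hM, Finset.mul_sum]
    refine Finset.sum_congr rfl fun z _ => ?_
    rw [Finset.sum_congr rfl fun v hv => by rw [blk_block hM z hv], Finset.sum_const, card_periodBox, nsmul_eq_mul,
      Nat.cast_pow]
  have hshift : ∀ (α : Fin d) (T : Finset (Fin d)),
      ∑ z ∈ periodBox (d := d) N, ‖dPot m (z + indic T) α‖ = ∑ z ∈ periodBox (d := d) N, ‖dPot m z α‖ := by
    intro α T
    refine sum_periodBox_shift N hN (g := fun z => ‖dPot m z α‖) (fun x κ => ?_) (indic T)
    simp only [dPot]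
    rw [add_right_comm, hm, hm]
  have hcard : ∀ α : Fin d, (((Finset.univ : Finset (Fin d)).erase α).powerset.card : ℝ) = (2 : ℝ) ^ (d - 1) := by
    intro α
    rw [Finset.card_powerset, Finset.card_erase_of_mem (Finset.mem_univ α), Finset.card_univ, Fintype.card_fin]
    push_cast; ring
  have hinner : ∀ α : Fin d, ∑ z ∈ periodBox (d := d) N,
      (1 / (M : ℝ)) * ∑ T ∈ (Finset.univ.erase α).powerset, ‖dPot m (z + indic T) α‖
      = (1 / (M : ℝ)) * ((2 : ℝ) ^ (d - 1) * ∑ z ∈ periodBox (d := d) N, ‖dPot m z α‖) := by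
    intro α
    rw [← Finset.mul_sum, Finset.sum_comm, Finset.sum_congr rfl fun T _ => hshift α T, Finset.sum_const, nsmul_eq_mul,
      hcard]
  calc ∑ y ∈ periodBox (d := d) (M * N), ∑ α : Fin d, ‖dPot (interp M Finset.univ m) y α‖
      ≤ ∑ y ∈ periodBox (d := d) (M * N), ∑ α : Fin d,
          (1 / (M : ℝ)) * ∑ T ∈ (Finset.univ.erase α).powerset, ‖dPot m (blk M y + indic T) α‖ :=
        Finset.sum_le_sum fun y _ => Finset.sum_le_sum fun α _ => hpt y α
    _ = (M : ℝ) ^ d * ∑ z ∈ periodBox (d := d) N, ∑ α : Fin d,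
          (1 / (M : ℝ)) * ∑ T ∈ (Finset.univ.erase α).powerset, ‖dPot m (z + indic T) α‖ := hblocks
    _ = (M : ℝ) ^ d * ∑ α : Fin d, (1 / (M : ℝ)) * ((2 : ℝ) ^ (d - 1) * ∑ z ∈ periodBox (d := d) N, ‖dPot m z α‖) := by
        rw [Finset.sum_comm, Finset.sum_congr rfl fun α _ => hinner α]
    _ = (2 : ℝ) ^ (d - 1) * ((M : ℝ) ^ d / (M : ℝ)) * ∑ z ∈ periodBox (d := d) N, ∑ α : Fin d, ‖dPot m z α‖ := by
        rw [← Finset.mul_sum, ← Finset.mul_sum, Finset.sum_comm]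
        ring

/-! ## §2 The ℓ¹ letters of the lift, of the corrector, and of the smooth right inverse -/

/-- **ℓ¹ LETTER OF THE LIFT**: `Σ_{y∈periodBox(M·N)} Σ_κ ‖smoothLift M φ y κ‖ ≤ 24·8^{d−1}·(M^d∕M)·Σ_{z∈periodBox N} Σ_κ ‖φ z κ‖` (`M ≥ 2`, `d ≥ 1`). [folklore] -/
theorem sum_norm_smoothLift_le {M : ℕ} (hM : 2 ≤ M) (hd : 1 ≤ d) (N : ℕ) (φ : Site d → Fin d → Matrix n n ℂ) :
    ∑ y ∈ periodBox (d := d) (M * N), ∑ κ : Fin d, ‖smoothLift M φ y κ‖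
      ≤ (24 * (8 : ℝ) ^ (d - 1)) * ((M : ℝ) ^ d / (M : ℝ)) * ∑ z ∈ periodBox (d := d) N, ∑ κ : Fin d, ‖φ z κ‖ := by
  have hM1 : 1 ≤ M := by omega
  have hM0 : (0 : ℝ) < M := by exact_mod_cast (by omega : 0 < M)
  calc ∑ y ∈ periodBox (d := d) (M * N), ∑ κ : Fin d, ‖smoothLift M φ y κ‖
      ≤ ∑ y ∈ periodBox (d := d) (M * N), ∑ κ : Fin d, (24 * (8 : ℝ) ^ (d - 1) / M) * ‖φ (blk M y) κ‖ :=
        Finset.sum_le_sum fun y _ => Finset.sum_le_sum fun κ _ => norm_smoothLift_le hM hd φ y κ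
    _ = (M : ℝ) ^ d * ∑ z ∈ periodBox (d := d) N, ∑ κ : Fin d, (24 * (8 : ℝ) ^ (d - 1) / M) * ‖φ z κ‖ := by
        rw [← sum_periodBox_blocks M N hM1, Finset.mul_sum]
        refine Finset.sum_congr rfl fun z _ => ?_
        rw [Finset.sum_congr rfl fun v hv => by rw [blk_block hM1 z hv], Finset.sum_const, card_periodBox, nsmul_eq_mul, Nat.cast_pow]
    _ = _ := by
        rw [Finset.mul_sum, Finset.mul_sum]
        refine Finset.sum_congr rfl fun z _ => ?_
        rw [Finset.mul_sum, Finset.mul_sum]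
        refine Finset.sum_congr rfl fun κ _ => ?_
        field_simp

/-- **ℓ¹ LETTER OF THE CORRECTOR** (`L ≥ 2`, `d ≥ 1`, `N ≥ 1`, `φ` `N`-periodic, `M = L^{j+1}`):
`Σ_{y∈periodBox(M·N)} Σ_α ‖dPot (interp M univ (framePot L (j+1) (smoothLift M φ))) y α‖ ≤ 2^d·d²·(24·8^{d−1})·(M^d∕M)·Σ_{z∈periodBox N} Σ_κ ‖φ z κ‖`. [folklore] -/
theorem sum_norm_corrector_le {L : ℕ} (hL : 2 ≤ L) (hd : 1 ≤ d) (j : ℕ) {N : ℕ} (hN : 1 ≤ N) {φ : Site d → Fin d → Matrix n n ℂ}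
    (hφ : ∀ (z : Site d) (τ κ : Fin d), φ (z + (N : ℤ) • e τ) κ = φ z κ) :
    ∑ y ∈ periodBox (d := d) (L ^ (j + 1) * N), ∑ α : Fin d,
        ‖dPot (interp (L ^ (j + 1)) Finset.univ (framePot L (j + 1) (smoothLift (L ^ (j + 1)) φ))) y α‖
      ≤ (2 : ℝ) ^ d * (d : ℝ) ^ 2 * (24 * (8 : ℝ) ^ (d - 1)) * (((L : ℝ) ^ (j + 1)) ^ d / (L : ℝ) ^ (j + 1))
          * ∑ z ∈ periodBox (d := d) N, ∑ κ : Fin d, ‖φ z κ‖ := by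
  have hL1 : 1 ≤ L := by omega
  have hM1 : 1 ≤ L ^ (j + 1) := Nat.one_le_pow _ _ hL1
  set G := framePot L (j + 1) (smoothLift (L ^ (j + 1)) φ) with hGdef
  set C := 24 * (8 : ℝ) ^ (d - 1) with hCdef
  set f : Site d → ℝ := fun z => ∑ κ : Fin d, ‖φ z κ‖ with hfdef
  have hG : ∀ (z : Site d) (τ : Fin d), G (z + (N : ℤ) • e τ) = G z := framePot_smoothLift_add_period hL1 j hφ
  have h1 := sum_norm_dPot_interp_le hM1 hN hG
  -- the local frame bound
  have hGb : ∀ z, ‖G z‖ ≤ d * C * f z := fun z =>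
    norm_framePot_smoothLift_le hL hd j φ z fun κ =>
      Finset.single_le_sum (f := fun κ' => ‖φ z κ'‖) (fun κ' _ => norm_nonneg (φ z κ')) (Finset.mem_univ κ)
  have hf : ∀ (x : Site d) (κ : Fin d), f (x + (N : ℤ) • e κ) = f x := fun x κ => by simp only [hfdef, hφ]
  have hshift : ∀ α : Fin d, ∑ z ∈ periodBox (d := d) N, f (z + e α) = ∑ z ∈ periodBox (d := d) N, f z :=
    fun α => sum_periodBox_shift N hN hf (e α)
  have h2 : ∑ z ∈ periodBox (d := d) N, ∑ α : Fin d, ‖dPot G z α‖ ≤ 2 * (d : ℝ) ^ 2 * C * ∑ z ∈ periodBox (d := d) N, f z := by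
    calc ∑ z ∈ periodBox (d := d) N, ∑ α : Fin d, ‖dPot G z α‖
        ≤ ∑ z ∈ periodBox (d := d) N, ∑ α : Fin d, (d * C) * (f (z + e α) + f z) := by
          refine Finset.sum_le_sum fun z _ => Finset.sum_le_sum fun α _ => ?_
          calc ‖dPot G z α‖ = ‖G (z + e α) - G z‖ := rfl
            _ ≤ ‖G (z + e α)‖ + ‖G z‖ := norm_sub_le _ _
            _ ≤ d * C * f (z + e α) + d * C * f z := add_le_add (hGb _) (hGb _)
            _ = _ := by ring
      _ = (d * C) * ∑ α : Fin d, ∑ z ∈ periodBox (d := d) N, (f (z + e α) + f z) := by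
          rw [Finset.sum_comm]
          simp only [← Finset.mul_sum]
      _ = (d * C) * (2 * d * ∑ z ∈ periodBox (d := d) N, f z) := by
          congr 1
          simp only [Finset.sum_add_distrib, hshift, Finset.sum_const, Finset.card_univ, Fintype.card_fin, nsmul_eq_mul]
          ring
      _ = _ := by ring
  -- assemble: `2^{d−1}·2 = 2^d`
  refine h1.trans ?_
  have hpow : (2 : ℝ) ^ d = 2 ^ (d - 1) * 2 := by rw [← pow_succ, show d - 1 + 1 = d by omega]
  have hK : 0 ≤ (2 : ℝ) ^ (d - 1) * ((((L ^ (j + 1) : ℕ) : ℝ)) ^ d / (((L ^ (j + 1) : ℕ) : ℝ))) := by positivity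
  refine (mul_le_mul_of_nonneg_left h2 hK).trans (le_of_eq ?_)
  rw [hpow]
  push_cast
  simp only [hfdef]
  ring

/-- **ℓ¹ LETTER** of the smooth right inverse (`L ≥ 2`, `d ≥ 1`, `N ≥ 1`, `φ` `N`-periodic, `M = L^{j+1}`):
`Σ_{y∈periodBox(M·N)} Σ_α ‖smoothRightInverse L j φ y α‖ ≤ 24·8^{d−1}·(1 + 2^d·d²)·(M^d∕M)·Σ_{z∈periodBox N} Σ_κ ‖φ z κ‖` — k-FREE, N-FREE
(d = 4: `3 158 016·M³`). [folklore] -/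
theorem sum_norm_smoothRightInverse_le {L : ℕ} (hL : 2 ≤ L) (hd : 1 ≤ d) (j : ℕ) {N : ℕ} (hN : 1 ≤ N) {φ : Site d → Fin d → Matrix n n ℂ}
    (hφ : ∀ (z : Site d) (τ κ : Fin d), φ (z + (N : ℤ) • e τ) κ = φ z κ) :
    ∑ y ∈ periodBox (d := d) (L ^ (j + 1) * N), ∑ α : Fin d, ‖smoothRightInverse L j φ y α‖
      ≤ (24 * (8 : ℝ) ^ (d - 1)) * (1 + (2 : ℝ) ^ d * (d : ℝ) ^ 2) * (((L : ℝ) ^ (j + 1)) ^ d / (L : ℝ) ^ (j + 1))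
          * ∑ z ∈ periodBox (d := d) N, ∑ κ : Fin d, ‖φ z κ‖ := by
  have hM2 : 2 ≤ L ^ (j + 1) := two_le_pow_succ hL j
  have hA := sum_norm_smoothLift_le hM2 hd N φ
  have hE := sum_norm_corrector_le hL hd j hN hφ
  push_cast at hA
  set A := smoothLift (L ^ (j + 1)) φ with hAdef
  set E := dPot (interp (L ^ (j + 1)) Finset.univ (framePot L (j + 1) A)) with hEdef
  set S := ∑ z ∈ periodBox (d := d) N, ∑ κ : Fin d, ‖φ z κ‖ with hSdef
  set Q := ((L : ℝ) ^ (j + 1)) ^ d / (L : ℝ) ^ (j + 1) with hQdef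
  set C := 24 * (8 : ℝ) ^ (d - 1) with hCdef
  have hR : smoothRightInverse L j φ = A + E := rfl
  rw [hR]
  calc ∑ y ∈ periodBox (d := d) (L ^ (j + 1) * N), ∑ α : Fin d, ‖(A + E) y α‖
      ≤ ∑ y ∈ periodBox (d := d) (L ^ (j + 1) * N), ∑ α : Fin d, (‖A y α‖ + ‖E y α‖) :=
        Finset.sum_le_sum fun y _ => Finset.sum_le_sum fun α _ => by rw [Pi.add_apply, Pi.add_apply]; exact norm_add_le _ _
    _ = ∑ y ∈ periodBox (d := d) (L ^ (j + 1) * N), ∑ α : Fin d, ‖A y α‖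
        + ∑ y ∈ periodBox (d := d) (L ^ (j + 1) * N), ∑ α : Fin d, ‖E y α‖ := by
        simp only [Finset.sum_add_distrib]
    _ ≤ C * Q * S + (2 : ℝ) ^ d * (d : ℝ) ^ 2 * C * Q * S := add_le_add hA hE
    _ = _ := by ring

end

end Summit.QuantumFields.BalabanUV.T4Continuum.NE3SmoothRightInverseL1
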